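import Summits.QuantumFields.YangMills.Theses.TransportPerturbation

/-!
# Route `TransportPerturbation` — support `PerturbationLemma` (stmt-QuantumFields-26989): the abstract Markov-chain perturbation
# lemma in Lyapunov-weighted transport form

Seat `ym-line-sfw-p1` g12 (2026-08-28).  Rung R3 is a RECORD-label rung (leaf `YM3TorusSU2`), not the Clay mass gap; this module is
pure measure theory and proves no step of any renormalisation-group argument.

THE LEMMA (Mitrophanov / Rudolf–Schweizer / Hairer–Mattingly–Scheutzow shape, as typed by planner ym-idea-5 g6): two probability laws
`μ0` on `Y₀`, `μ1` on `Y₁` are read on a common space `X` through measurable maps `toC`, `sd`; `S : X → X → [0,4]` is a bounded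
cost, `Λ ≥ 0` a bounded measurable WEIGHT with first moments `≤ D` under both laws, and `Q` an operator on functions `X → ℝ` which
(a) maps every weighted Lipschitz class `𝒢(B) = {g measurable, |g| ≤ 1, |g u − g v| ≤ B √(S(u,v)(1 + Λ u + Λ v))}` into `𝒢(κB)` with
`κ < 1`, (b) almost preserves the `μ1`-side law on `𝒢(B)`: `|∫ g∘sd dμ1 − ∫ (Qg)∘sd dμ1| ≤ B·R`, and (c) exactly preserves the
`μ0`-side law on bounded measurable functions.  CONCLUSION: every `S`-Lipschitz `f` (`|f| ≤ 1`, `|f u − f v| ≤ A S(u,v)`) has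
`|∫ f∘sd dμ1 − ∫ f∘toC dμ0| ≤ 2A|R|/(1−κ)`.

PROOF (`perturbationLemma_proof`, the planner's sketch made exact): `S ≤ 2√S ≤ 2√(S(1+Λu+Λv))` puts `f ∈ 𝒢(2A)`; iterating (a),
`Qⁿf ∈ 𝒢(κⁿ·2A)`; telescoping `ν(f) − ν(Q^N f) = Σ_{n<N} (ν(Qⁿf) − ν(Qⁿ⁺¹f))` with (b) gives `≤ 2A|R| Σ κⁿ ≤ 2A|R|/(1−κ)`
(`ν = ∫ (·)∘sd dμ1`); (c) iterated gives `μ(Q^N f) = μ(f)` (`μ = ∫ (·)∘toC dμ0`); and `√(S(1+Λu+Λv)) ≤ 2 + Λ u + Λ v` makes `Q^N f`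
constant up to `2Aκ^N (2 + Λ u + Λ v)`, so `|ν(Q^N f) − μ(Q^N f)| ≤ 2Aκ^N (2 + 2D) → 0` as `N → ∞`.
No definitions, no named facts, no `sorry`. [cite: RudolfSchweizer2018, Thm 3.1] [cite: HairerMattinglyScheutzow2011, Thm 4.8]
-/

set_option autoImplicit false

noncomputable section

open MeasureTheory Filter Topology

namespace Summit.QuantumFields.YangMills.Theorems.TransportPerturbation

/-! ## §1 Two elementary square-root inequalities -/

/-- For `0 ≤ s ≤ 4` and `0 ≤ x`: `s ≤ 2 √(s (1 + x))` (`s = √s·√s ≤ 2√s` and `√s ≤ √(s(1+x))`). [folklore] -/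
theorem le_two_mul_sqrt_mul_one_add {s x : ℝ} (hs0 : 0 ≤ s) (hs4 : s ≤ 4) (hx : 0 ≤ x) :
    s ≤ 2 * Real.sqrt (s * (1 + x)) := by
  have h1 : Real.sqrt s ≤ 2 := by
    rw [show (2 : ℝ) = Real.sqrt 4 by rw [show (4 : ℝ) = 2 ^ 2 by norm_num, Real.sqrt_sq (by norm_num)]]
    exact Real.sqrt_le_sqrt hs4
  have h2 : Real.sqrt s ≤ Real.sqrt (s * (1 + x)) :=
    Real.sqrt_le_sqrt (le_mul_of_one_le_right hs0 (by linarith))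
  calc s = Real.sqrt s * Real.sqrt s := (Real.mul_self_sqrt hs0).symm
    _ ≤ 2 * Real.sqrt (s * (1 + x)) :=
        mul_le_mul h1 h2 (Real.sqrt_nonneg _) (by norm_num)

/-- For `s ≤ 4` and `0 ≤ x`: `√(s (1 + x)) ≤ 2 + x` (`s(1+x) ≤ 4(1+x) ≤ (2+x)²`). [folklore] -/
theorem sqrt_mul_one_add_le {s x : ℝ} (hs4 : s ≤ 4) (hx : 0 ≤ x) :
    Real.sqrt (s * (1 + x)) ≤ 2 + x := by
  rw [Real.sqrt_le_left]
  · nlinarith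
  · linarith

/-- Partial geometric sums of a ratio `0 ≤ κ < 1` are bounded by `1/(1 − κ)`. [folklore] -/
theorem geom_sum_le_inv_one_sub {κ : ℝ} (hκ0 : 0 ≤ κ) (hκ1 : κ < 1) (N : ℕ) :
    ∑ n ∈ Finset.range N, κ ^ n ≤ 1 / (1 - κ) := by
  have h1 : 0 < 1 - κ := sub_pos.mpr hκ1
  rw [le_div_iff₀ h1, geom_sum_mul_neg]
  have : 0 ≤ κ ^ N := pow_nonneg hκ0 N
  linarith

/-! ## §2 Integrals of bounded functions against the two laws -/

section Integrals

variable {X Y : Type} [MeasurableSpace X] [MeasurableSpace Y]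

/-- A bounded measurable function read through a measurable map is integrable against a probability law. [folklore] -/
theorem integrable_comp_of_abs_le (μ : Measure Y) [IsProbabilityMeasure μ] {φ : Y → X} (hφ : Measurable φ) {g : X → ℝ}
    (hg : Measurable g) {C : ℝ} (hC : ∀ u, |g u| ≤ C) : Integrable (fun y => g (φ y)) μ :=
  Integrable.of_bound ((hg.comp hφ).aestronglyMeasurable) C (ae_of_all _ fun y => by
    rw [Real.norm_eq_abs]; exact hC _)

/-- A non-negative measurable function bounded by `M`, read through a measurable map, is integrable against a probability law. [folklore] -/
theorem integrable_comp_of_nonneg_le (μ : Measure Y) [IsProbabilityMeasure μ] {φ : Y → X} (hφ : Measurable φ) {Λ : X → ℝ}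
    (hΛ : Measurable Λ) (hΛ0 : ∀ u, 0 ≤ Λ u) {M : ℝ} (hM : ∀ u, Λ u ≤ M) : Integrable (fun y => Λ (φ y)) μ :=
  Integrable.of_bound ((hΛ.comp hφ).aestronglyMeasurable) M (ae_of_all _ fun y => by
    rw [Real.norm_eq_abs, abs_of_nonneg (hΛ0 _)]; exact hM _)

omit [MeasurableSpace X] in
/-- The mean of a constant under a probability law. [folklore] -/
theorem integral_const_of_prob (μ : Measure Y) [IsProbabilityMeasure μ] (c : ℝ) : ∫ _y, c ∂μ = c := by
  simp

/-- **Near-constant functions have near-equal means under any two laws**: if `|h u − h v| ≤ c (2 + Λ u + Λ v)` (`c ≥ 0`) and the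
weight `Λ ≥ 0` (bounded, measurable) has first moments `≤ D₀`, `≤ D₁` under the two laws (read through `toC`, `sd`), then
`|∫ h∘sd dμ1 − ∫ h∘toC dμ0| ≤ c (2 + D₁ + D₀)`. [folklore] -/
theorem abs_integral_sub_integral_le_of_near_const {Y₀ Y₁ : Type} [MeasurableSpace Y₀] [MeasurableSpace Y₁]
    (μ0 : Measure Y₀) (μ1 : Measure Y₁) [IsProbabilityMeasure μ0] [IsProbabilityMeasure μ1]
    {toC : Y₀ → X} {sd : Y₁ → X} (htoC : Measurable toC) (hsd : Measurable sd)
    {Λ : X → ℝ} (hΛ : Measurable Λ) (hΛ0 : ∀ u, 0 ≤ Λ u) {M : ℝ} (hM : ∀ u, Λ u ≤ M)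
    {D₀ D₁ : ℝ} (hD0 : ∫ y, Λ (toC y) ∂μ0 ≤ D₀) (hD1 : ∫ y, Λ (sd y) ∂μ1 ≤ D₁)
    {h : X → ℝ} (hh : Measurable h) (hh1 : ∀ u, |h u| ≤ 1) {c : ℝ} (hc : 0 ≤ c)
    (hnear : ∀ u v, |h u - h v| ≤ c * (2 + Λ u + Λ v)) :
    |(∫ y, h (sd y) ∂μ1) - ∫ y, h (toC y) ∂μ0| ≤ c * (2 + D₁ + D₀) := by
  set m : ℝ := ∫ y, h (toC y) ∂μ0 with hm
  have hIh1 : Integrable (fun y => h (sd y)) μ1 := integrable_comp_of_abs_le μ1 hsd hh hh1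
  have hIh0 : Integrable (fun y => h (toC y)) μ0 := integrable_comp_of_abs_le μ0 htoC hh hh1
  have hIΛ1 : Integrable (fun y => Λ (sd y)) μ1 := integrable_comp_of_nonneg_le μ1 hsd hΛ hΛ0 hM
  have hIΛ0 : Integrable (fun y => Λ (toC y)) μ0 := integrable_comp_of_nonneg_le μ0 htoC hΛ hΛ0 hM
  -- pointwise: `|h(sd y₁) − m| ≤ c (2 + Λ(sd y₁) + D₀)`
  have hpt : ∀ y₁ : Y₁, |h (sd y₁) - m| ≤ c * (2 + Λ (sd y₁) + D₀) := by
    intro y₁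
    have hconst : h (sd y₁) - m = ∫ y, (h (sd y₁) - h (toC y)) ∂μ0 := by
      rw [integral_sub (integrable_const _) hIh0, integral_const_of_prob]
    have hIc : Integrable (fun _y : Y₀ => (2 : ℝ) + Λ (sd y₁)) μ0 := integrable_const _
    rw [hconst]
    calc |∫ y, (h (sd y₁) - h (toC y)) ∂μ0| ≤ ∫ y, |h (sd y₁) - h (toC y)| ∂μ0 := by
          simpa only [Real.norm_eq_abs] using norm_integral_le_integral_norm (fun y => h (sd y₁) - h (toC y))
      _ ≤ ∫ y, c * (2 + Λ (sd y₁) + Λ (toC y)) ∂μ0 := by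
          refine integral_mono_of_nonneg (ae_of_all _ fun y => abs_nonneg _) ?_ (ae_of_all _ fun y => hnear _ _)
          exact (hIc.add hIΛ0).const_mul c
      _ = c * (2 + Λ (sd y₁) + ∫ y, Λ (toC y) ∂μ0) := by
          rw [integral_const_mul, integral_add hIc hIΛ0, integral_const_of_prob]
      _ ≤ c * (2 + Λ (sd y₁) + D₀) := by
          exact mul_le_mul_of_nonneg_left (by linarith) hc
  -- integrate over `μ1`
  have hsub : (∫ y, h (sd y) ∂μ1) - m = ∫ y, (h (sd y) - m) ∂μ1 := by
    rw [integral_sub hIh1 (integrable_const _), integral_const_of_prob]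
  have hI2 : Integrable (fun y : Y₁ => (2 : ℝ) + Λ (sd y)) μ1 := (integrable_const _).add hIΛ1
  rw [hsub]
  calc |∫ y, (h (sd y) - m) ∂μ1| ≤ ∫ y, |h (sd y) - m| ∂μ1 := by
        simpa only [Real.norm_eq_abs] using norm_integral_le_integral_norm (fun y => h (sd y) - m)
    _ ≤ ∫ y, c * (2 + Λ (sd y) + D₀) ∂μ1 := by
        refine integral_mono_of_nonneg (ae_of_all _ fun y => abs_nonneg _) ?_ (ae_of_all _ fun y => hpt y)
        exact (hI2.add (integrable_const _)).const_mul c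
    _ = c * (2 + (∫ y, Λ (sd y) ∂μ1) + D₀) := by
        rw [integral_const_mul, integral_add hI2 (integrable_const _), integral_add (integrable_const _) hIΛ1,
          integral_const_of_prob, integral_const_of_prob]
    _ ≤ c * (2 + D₁ + D₀) := mul_le_mul_of_nonneg_left (by linarith) hc

end Integrals

/-! ## §3 The perturbation lemma -/

/-- ★★★ **`PerturbationLemma` (stmt-QuantumFields-26989) — the abstract Markov-chain perturbation lemma in Lyapunov-weighted
transport form**, exactly as typed in the route file: contraction of the weighted classes by `κ < 1`, `R`-almost invariance of the
`μ1`-side law on them and exact invariance of the `μ0`-side law give `|∫ f∘sd dμ1 − ∫ f∘toC dμ0| ≤ 2A|R|/(1−κ)` for every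
`S`-Lipschitz `f` with constant `A`. [cite: RudolfSchweizer2018, Thm 3.1] [cite: HairerMattinglyScheutzow2011, Thm 4.8] -/
theorem perturbationLemma_proof : Summit.QuantumFields.YangMills.Theses.TransportPerturbation.PerturbationLemma := by
  intro X Y₀ Y₁ _ _ _ μ0 μ1 _ _ toC sd htoC hsd S Λ Q κ A R D M f hκ0 hκ1 hA hD hS0 hS4 hΛ hΛ0 hΛM hD0 hD1 hf hQ hR hinv
  -- the two functionals
  set ν : (X → ℝ) → ℝ := fun g => ∫ y, g (sd y) ∂μ1 with hν
  set μ : (X → ℝ) → ℝ := fun g => ∫ y, g (toC y) ∂μ0 with hμ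
  -- `f ∈ 𝒢(2A)`: `A·S ≤ 2A √(S (1 + Λ u + Λ v))`
  have hf2A : Measurable f ∧ (∀ u, |f u| ≤ 1) ∧
      ∀ u v, |f u - f v| ≤ (2 * A) * Real.sqrt (S u v * (1 + Λ u + Λ v)) := by
    refine ⟨hf.1, hf.2.1, fun u v => (hf.2.2 u v).trans ?_⟩
    have h := le_two_mul_sqrt_mul_one_add (hS0 u v) (hS4 u v) (x := Λ u + Λ v) (by linarith [hΛ0 u, hΛ0 v])
    calc A * S u v ≤ A * (2 * Real.sqrt (S u v * (1 + (Λ u + Λ v)))) := mul_le_mul_of_nonneg_left h hA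
      _ = 2 * A * Real.sqrt (S u v * (1 + Λ u + Λ v)) := by rw [← add_assoc]; ring
  -- `Qⁿ f ∈ 𝒢(κⁿ·2A)` (iterate hypothesis (a))
  have hit : ∀ n : ℕ, Measurable (Q^[n] f) ∧ (∀ u, |(Q^[n] f) u| ≤ 1) ∧
      ∀ u v, |(Q^[n] f) u - (Q^[n] f) v| ≤ (κ ^ n * (2 * A)) * Real.sqrt (S u v * (1 + Λ u + Λ v)) := by
    intro n
    induction n with
    | zero => simpa using hf2A
    | succ n ih =>
      have h := hQ _ _ ih
      rw [Function.iterate_succ_apply', pow_succ]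
      refine ⟨h.1, h.2.1, fun u v => (h.2.2 u v).trans_eq ?_⟩
      ring
  have hBn : ∀ n : ℕ, 0 ≤ κ ^ n * (2 * A) := fun n => mul_nonneg (pow_nonneg hκ0 n) (by linarith)
  -- (c) iterated: `μ (Qⁿ f) = μ f`
  have hμinv : ∀ n : ℕ, μ (Q^[n] f) = μ f := by
    intro n
    induction n with
    | zero => rfl
    | succ n ih =>
      rw [← ih, Function.iterate_succ_apply']
      exact hinv _ (hit n).1 (hit n).2.1
  -- (b) telescoped: `|ν f − ν (Q^N f)| ≤ 2A|R|/(1−κ)`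
  have htel : ∀ N : ℕ, |ν f - ν (Q^[N] f)| ≤ 2 * A * |R| / (1 - κ) := by
    intro N
    have hsum : ν f - ν (Q^[N] f) = ∑ n ∈ Finset.range N, (ν (Q^[n] f) - ν (Q^[n + 1] f)) := by
      rw [Finset.sum_range_sub']
      rfl
    rw [hsum]
    calc |∑ n ∈ Finset.range N, (ν (Q^[n] f) - ν (Q^[n + 1] f))|
        ≤ ∑ n ∈ Finset.range N, |ν (Q^[n] f) - ν (Q^[n + 1] f)| := Finset.abs_sum_le_sum_abs _ _
      _ ≤ ∑ n ∈ Finset.range N, κ ^ n * (2 * A) * |R| := by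
          refine Finset.sum_le_sum fun n _ => ?_
          have h := hR _ _ (hit n)
          rw [Function.iterate_succ_apply']
          exact h.trans (mul_le_mul_of_nonneg_left (le_abs_self R) (hBn n))
      _ = 2 * A * |R| * ∑ n ∈ Finset.range N, κ ^ n := by
          rw [Finset.mul_sum]
          exact Finset.sum_congr rfl fun n _ => by ring
      _ ≤ 2 * A * |R| * (1 / (1 - κ)) :=
          mul_le_mul_of_nonneg_left (geom_sum_le_inv_one_sub hκ0 hκ1 N) (by positivity)
      _ = 2 * A * |R| / (1 - κ) := by ring
  -- near-constancy of `Q^N f`: `√(S(1+Λu+Λv)) ≤ 2 + Λu + Λv`, hence `|ν (Q^N f) − μ (Q^N f)| ≤ κ^N·2A·(2 + 2D)`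
  have hnear : ∀ (N : ℕ) (u v : X), |(Q^[N] f) u - (Q^[N] f) v| ≤ κ ^ N * (2 * A) * (2 + Λ u + Λ v) := by
    intro N u v
    refine ((hit N).2.2 u v).trans (mul_le_mul_of_nonneg_left ?_ (hBn N))
    have h := sqrt_mul_one_add_le (hS4 u v) (x := Λ u + Λ v) (by linarith [hΛ0 u, hΛ0 v])
    calc Real.sqrt (S u v * (1 + Λ u + Λ v)) = Real.sqrt (S u v * (1 + (Λ u + Λ v))) := by rw [add_assoc]
      _ ≤ 2 + (Λ u + Λ v) := h
      _ = 2 + Λ u + Λ v := (add_assoc _ _ _).symm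
  have hmid : ∀ N : ℕ, |ν (Q^[N] f) - μ (Q^[N] f)| ≤ κ ^ N * (2 * A) * (2 + D + D) := fun N =>
    abs_integral_sub_integral_le_of_near_const μ0 μ1 htoC hsd hΛ hΛ0 hΛM hD0 hD1 (hit N).1 (hit N).2.1 (hBn N)
      (hnear N)
  -- assemble at every `N`, then let `N → ∞`
  have hall : ∀ N : ℕ, |ν f - μ f| ≤ 2 * A * |R| / (1 - κ) + κ ^ N * ((2 * A) * (2 + D + D)) := by
    intro N
    have htri : |ν f - μ f| ≤ |ν f - ν (Q^[N] f)| + |ν (Q^[N] f) - μ (Q^[N] f)| := by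
      rw [← hμinv N]
      exact abs_sub_le _ _ _
    calc |ν f - μ f| ≤ |ν f - ν (Q^[N] f)| + |ν (Q^[N] f) - μ (Q^[N] f)| := htri
      _ ≤ 2 * A * |R| / (1 - κ) + κ ^ N * (2 * A) * (2 + D + D) := add_le_add (htel N) (hmid N)
      _ = 2 * A * |R| / (1 - κ) + κ ^ N * ((2 * A) * (2 + D + D)) := by ring
  have hlim : Tendsto (fun N : ℕ => 2 * A * |R| / (1 - κ) + κ ^ N * ((2 * A) * (2 + D + D))) atTop
      (𝓝 (2 * A * |R| / (1 - κ) + 0 * ((2 * A) * (2 + D + D)))) :=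
    tendsto_const_nhds.add ((tendsto_pow_atTop_nhds_zero_of_lt_one hκ0 hκ1).mul tendsto_const_nhds)
  rw [zero_mul, add_zero] at hlim
  exact ge_of_tendsto' hlim hall

end Summit.QuantumFields.YangMills.Theorems.TransportPerturbation

end
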